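import Summits.ResolutionOfSingularities.ResolutionOfSingularities.Theses.HomologicalConductor

/-!
# Crux attack on `HomologicalConductor.NoZeno` (stmt-ResolutionOfSingularities-16483) — refuter record

Kernel-checked bookkeeping for the crux-attack cycle (refuter-rattack-…-16483-0, 2026-08-17):

* `noZeno_of_termination` — the crux is implied by its own conclusion (unconditional valuative
  termination, = the antecedent of `Globalisation` at every prime); the two hypotheses only weaken it.
* `persistence_and_strictDrop_of_not_noZeno` — STRUCTURAL: any refutation `¬ NoZeno` carries proofs
  of BOTH sibling cruxes `Persistence` and `StrictDrop` (global hypotheses), so the crux is not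
  falsifiable in isolation; a Zeno tower found in nature kills the ROUTE (planner's kill criterion)
  but formally lands on `SurfaceTermination`/`Globalisation`'s antecedent, never on `NoZeno`.
* `algebraMap_mem_of_le` — the hypothesis `∀ c : k, algebraMap k K c ∈ O` of every item is redundant
  given `A.toSubring ≤ O.toSubring` (harmless decoration).
-/

-- single-problem summit: the doubled namespace component is forced
set_option linter.dupNamespace false

namespace Summit.ResolutionOfSingularities.ResolutionOfSingularities.Cruxes.NoZeno.Attack

open Summit.ResolutionOfSingularities.ResolutionOfSingularities.Theses.HomologicalConductor

/-- Unconditional valuative termination of the canonical `ca`-tower (the conclusion of `NoZeno`,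
verbatim; equivalently `∀ p prime, <antecedent of Globalisation at p>`). -/
def Termination : Prop :=
  ∀ p : ℕ, p.Prime → ∀ (k K : Type) [Field k] [CharP k p] [Field K] [Algebra k K] (O : ValuationSubring K) (A : Subalgebra k K), (∀ c : k, algebraMap k K c ∈ O) → A.FG → IsFractionRing ↥A K → A.toSubring ≤ O.toSubring → let ca : Subalgebra k K → Set K := fun A => {x : K | ∃ hx : x ∈ A, ∃ n : ℕ, ∀ i : ℕ, n ≤ i → ∀ (M N : ModuleCat.{0} ↥A), Module.Finite ↥A M → Module.Finite ↥A N → ∀ e : CategoryTheory.Abelian.Ext.{0} M N i, (⟨x, hx⟩ : ↥A) • e = 0}; let loc : Subalgebra k K → Subalgebra k K := fun A => Algebra.adjoin k {y : K | ∃ a ∈ A, ∃ s ∈ A, s⁻¹ ∈ O ∧ y = a * s⁻¹}; let chart : Subalgebra k K → Subalgebra k K := fun A => Algebra.adjoin k ((A : Set K) ∪ {y : K | ∃ c ∈ ca A, ∃ x ∈ ca A, x ≠ 0 ∧ (∀ c' ∈ ca A, c' * x⁻¹ ∈ O) ∧ y = c * x⁻¹}); let nrm : Subalgebra k K → Subalgebra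 k K := fun B => Algebra.adjoin k {y : K | IsIntegral ↥B y}; let tower : Subalgebra k K → ℕ → Subalgebra k K := fun A m => @Nat.rec (fun _ => Subalgebra k K) (loc A) (fun _ B => loc (nrm (chart B))) m; ∃ m : ℕ, IsRegularLocalRing ↥(tower A m)

/-- The crux follows from its own conclusion: the hypotheses `Persistence`, `StrictDrop` only
weaken it (so `NoZeno` is at most as hard as unconditional termination). -/
theorem noZeno_of_termination (h : Termination) : NoZeno :=
  fun _ _ p hp k K _ _ _ _ O A hk hfg hfr hAO => h p hp k K O A hk hfg hfr hAO

/-- STRUCTURAL (unfalsifiability in isolation): a proof of `¬ NoZeno` contains proofs of the two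
sibling cruxes `Persistence` and `StrictDrop` and a failure of termination. -/
theorem persistence_and_strictDrop_of_not_noZeno (h : ¬ NoZeno) :
    Persistence ∧ StrictDrop ∧ ¬ Termination := by
  refine ⟨?_, ?_, fun hT => h (noZeno_of_termination hT)⟩
  · by_contra hP
    exact h (fun hP' _ => absurd hP' hP)
  · by_contra hD
    exact h (fun _ hD' => absurd hD' hD)

/-- Conversely. -/
theorem not_noZeno_iff : ¬ NoZeno ↔ Persistence ∧ StrictDrop ∧ ¬ Termination :=
  ⟨persistence_and_strictDrop_of_not_noZeno,
    fun ⟨hP, hD, hT⟩ h => hT (fun p hp k K _ _ _ _ O A hk hfg hfr hAO => h hP hD p hp k K O A hk hfg hfr hAO)⟩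

/-- The hypothesis `∀ c : k, algebraMap k K c ∈ O` is implied by `A.toSubring ≤ O.toSubring`
(every `k`-subalgebra contains the image of `k`): redundant decoration in all seven items. -/
theorem algebraMap_mem_of_le {k K : Type} [Field k] [Field K] [Algebra k K]
    (O : ValuationSubring K) (A : Subalgebra k K) (hAO : A.toSubring ≤ O.toSubring) (c : k) :
    algebraMap k K c ∈ O := by
  have : algebraMap k K c ∈ A.toSubring := A.algebraMap_mem c
  exact hAO this

/-! ## Degenerate slice `O = K` (trivial valuation): the conclusion HOLDS with `m = 0`
(`T₀ = loc A = K`, a field, hence a regular local ring) — the degenerate model is not junk-false. -/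

section Slice

variable {k K : Type} [Field k] [Field K] [Algebra k K]

/-- Along the trivial valuation ring `⊤ = K`, localising `A` at the centre inverts everything:
`loc A = K`. -/
theorem loc_top_eq_top (A : Subalgebra k K) (hfr : IsFractionRing ↥A K) :
    Algebra.adjoin k {y : K | ∃ a ∈ A, ∃ s ∈ A, s⁻¹ ∈ (⊤ : ValuationSubring K) ∧ y = a * s⁻¹} = ⊤ := by
  refine eq_top_iff.mpr fun z _ => Algebra.subset_adjoin ?_
  obtain ⟨a, s, -, rfl⟩ := IsFractionRing.div_surjective (A := ↥A) z
  refine ⟨a, a.2, s, s.2, ValuationSubring.mem_top _, ?_⟩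
  change (a : K) / (s : K) = (a : K) * (s : K)⁻¹
  rw [div_eq_mul_inv]

/-- `K` itself (as the top subalgebra) is a regular local ring. -/
theorem isRegularLocalRing_subalgebra_top : IsRegularLocalRing ↥(⊤ : Subalgebra k K) :=
  IsRegularLocalRing.of_ringEquiv (Subalgebra.topEquiv (R := k) (A := K)).symm.toRingEquiv

/-- DEGENERATE SLICE of the crux's conclusion: for the trivial valuation ring `O = ⊤` the canonical
tower is already regular at stage `0` (no junk falsity in the degenerate model; the statement's
content is entirely in non-trivial valuations). Same binders and `let`-tower as `NoZeno`'s
conclusion, with the extra hypothesis `O = ⊤`. -/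
theorem conclusion_of_top : ∀ p : ℕ, p.Prime → ∀ (k K : Type) [Field k] [CharP k p] [Field K] [Algebra k K] (O : ValuationSubring K) (A : Subalgebra k K), (∀ c : k, algebraMap k K c ∈ O) → A.FG → IsFractionRing ↥A K → A.toSubring ≤ O.toSubring → O = ⊤ → let ca : Subalgebra k K → Set K := fun A => {x : K | ∃ hx : x ∈ A, ∃ n : ℕ, ∀ i : ℕ, n ≤ i → ∀ (M N : ModuleCat.{0} ↥A), Module.Finite ↥A M → Module.Finite ↥A N → ∀ e : CategoryTheory.Abelian.Ext.{0} M N i, (⟨x, hx⟩ : ↥A) • e = 0}; let loc : Subalgebra k K → Subalgebra k K := fun A => Algebra.adjoin k {y : K | ∃ a ∈ A, ∃ s ∈ A, s⁻¹ ∈ O ∧ y = a * s⁻¹}; let chart : Subalgebra k K → Subalgebra k K := fun A => Algebra.adjoin k ((A : Set K) ∪ {y : K | ∃ c ∈ ca A, ∃ x ∈ ca A, x ≠ 0 ∧ (∀ c' ∈ ca A, c' * x⁻¹ ∈ O) ∧ y = c * x⁻¹}); let nrm : Subalgebra k K → Subalgebra k K := fun B => Algebra.adjoin k {y : K | IsIntegral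 ↥B y}; let tower : Subalgebra k K → ℕ → Subalgebra k K := fun A m => @Nat.rec (fun _ => Subalgebra k K) (loc A) (fun _ B => loc (nrm (chart B))) m; ∃ m : ℕ, IsRegularLocalRing ↥(tower A m) := by
  intro p hp k K _ _ _ _ O A hk hfg hfr hAO hO
  subst hO
  intro ca loc chart nrm tower
  refine ⟨0, ?_⟩
  have h : loc A = ⊤ := loc_top_eq_top A hfr
  show IsRegularLocalRing ↥(loc A)
  rw [h]
  exact isRegularLocalRing_subalgebra_top

end Slice

end Summit.ResolutionOfSingularities.ResolutionOfSingularities.Cruxes.NoZeno.Attack
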